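import Literature.NumberTheory.LFunctions.ThetaChainFreeCheck
import HarnessLib

/-!
# Schoenfeld's `θ`-bound on `[599, 10⁸]` by kernel computation: data-free run, chunk 23 of 35

Topic: `Literature/NumberTheory/LFunctions`. Pure proof file (a kernel computation; nothing is
asserted, no definition). The theorems below evaluate `ThetaChain.runFree` — together `150000`
data-free steps of the certified `θ`-chain (`ThetaChain.stepFree`, `ThetaChainFreeCheck.lean`: the
next prime found and certified by two gcds with the primorials of the odd primes `≤ 2999` and in
`(2999, 10007]`, the enclosures of `log p` and `θ(p)`, and the two comparisons behind
`|θ(x) − x| ≤ √x log² x/(8π)`) — from the state at the prime `65985989` to the state at the prime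
`68686747`. Soundness: `ThetaChain.runFree_sound`; assembly of the 35 chunks: `ThetaUpTo1e8.lean`.
The expected states were obtained by evaluating a twin of the same function outside the kernel
(validated bit-for-bit on the tree's chunk `ThetaChainRun.xrun14`). Declarations of `5·10⁴` steps
(about `70 s` of kernel time each; the kernel's evaluation is linear within a declaration of this size),
`decide +kernel`, standard axioms only (`maxHeartbeats 0` lifts the deterministic time-out).

## References

* L. Schoenfeld, *Sharper bounds for the Chebyshev functions θ(x) and ψ(x). II*, Math. Comp. 30
  (1976), 337–360, Thm. 10 (6.3). [Schoenfeld1976]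
* J. B. Rosser, L. Schoenfeld, *Approximate formulas for some functions of prime numbers*,
  Illinois J. Math. 6 (1962), 64–94, Thms. 18–19 (`θ`-tables to `10⁸`). [RosserSchoenfeld1962]
-/

namespace Literature.NumberTheory.LFunctions.ThetaChainRun

open ThetaChain

set_option maxHeartbeats 0 in
/-- **Data-free certified `θ`-run, chunk 23a** (steps `3300001`–`3350000` after `8886113`: 50000 primes,
`65985989` to `66883723`). [cite: Schoenfeld1976, Thm. 10 (6.3)] -/
theorem frun23a :
    runFree 50000
      ⟨65985989, 21766652550045374798108279, 21766652550045850482295051, 79759200810049714044256580773868, 79759200810051566849074619528872⟩ =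
    some ⟨66883723, 21782989009431250090214365, 21782989009431725775352022, 80847942240303713062149752902818, 80847942240305589651200903365307⟩ := by
  decide +kernel

set_option maxHeartbeats 0 in
/-- **Data-free certified `θ`-run, chunk 23b** (steps `3350001`–`3400000` after `8886113`: 50000 primes,
`66883723` to `67784033`). [cite: Schoenfeld1976, Thm. 10 (6.3)] -/
theorem frun23b :
    runFree 50000
      ⟨66883723, 21782989009431250090214365, 21782989009431725775352022, 80847942240303713062149752902818, 80847942240305589651200903365307⟩ =
    some ⟨67784033, 21799153594819918434834138, 21799153594820394120922420, 81937497052556631366308277917462, 81937497052558531739640077589651⟩ := by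
  decide +kernel

set_option maxHeartbeats 0 in
/-- **Data-free certified `θ`-run, chunk 23c** (steps `3400001`–`3450000` after `8886113`: 50000 primes,
`67784033` to `68686747`). [cite: Schoenfeld1976, Thm. 10 (6.3)] -/
theorem frun23c :
    runFree 50000
      ⟨67784033, 21799153594819918434834138, 21799153594820394120922420, 81937497052556631366308277917462, 81937497052558531739640077589651⟩ =
    some ⟨68686747, 21815147204284437715757914, 21815147204284913402796881, 83027855188440445299663445545561, 83027855188442369457323427672045⟩ := by
  decide +kernel

end Literature.NumberTheory.LFunctions.ThetaChainRun
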